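import Literature.Computability.MetaComplexity.MCSPTableWalkStep
import Literature.Computability.MetaComplexity.MCSPTreeWalk
import HarnessLib

/-!
# The `MCSP` table machine, II: the label of a leaf of a hybrid GGM tree is in `FP` (proofs)

Part of the proof architecture of the named fact `AllenderEtAl2006_MCSP_universalInverter`
(`MCSPUniversalInverter.lean`; Allender–Buhrman–Koucký–van Melkebeek–Ronneburger 2006, Thm. 45
with §4.2): the second brick of the polynomial-time string function writing the truth table of a
hybrid of the GGM tree (hypothesis `hTab` of `mcsp_universalInverter_of_hill_of_tables`). The
walk body of `MCSPTableWalkStep.lean` (`exists_walkBody`) is iterated `k` times by the counted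
loop `Brick.loopFn_mem_FP`, from the root label; `exists_walk` packages the resulting `FP`
function with its semantics: on `⟨X, x₀⟩`, `X = ⟨y, ⟨z, ⟨ρ ⇂ (k+ℓ), ⟨1^ℓ, ⟨bin k, ⟨bin i, bin t⟩⟩⟩⟩⟩⟩`
and `x₀ = ρ[k, k+ℓ)` the root label, it returns (the bit string of) the label of leaf `t` of
the distinguisher tree `distLab` of `MetaComplexity/GGM.lean` with step maps the halves of
`s ↦ G ⟨y, s⟩`, fresh labels `ρ[k+ℓ+(2n+b)ℓ, +ℓ)`, challenge the halves of `z`, planted at node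
`i` — the loop invariant being the arithmetic walk `distLab_ancestor_succ` of `MCSPTreeWalk.lean`.

* `take_drop_eq_ofFn_getD`, `ofFn_getD_cond_eq_take_drop` — blocks of a string as `List.ofFn`
  of positional reads;
* **`exists_walk`**.

Theorems only.

## References

* E. Allender et al., *Power from random strings*, SIAM J. Comput. 35(6) (2006)
  [AllenderEtAl2006]: proof of Thm. 45 (p. 24).
* A. A. Razborov, S. Rudich, *Natural proofs*, JCSS 55 (1997) [RazborovRudich1997]: proof of
  Thm. 4.1.
* S. Arora, B. Barak, *Computational Complexity: A Modern Approach*, CUP 2009 [AroraBarak2009]: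
  §1.3 (bounded loops), proof of Thm. 9.17 (the GGM tree).
-/

namespace Literature.Computability.MetaComplexity

open _root_.Computability Complexity Complexity.Brick

/-! ### Blocks of a string as positional reads -/

/-- A block `w[a, a+ℓ)` inside `w` is the list of the positional reads `w[a + j]`, `j < ℓ`.
[folklore] -/
theorem take_drop_eq_ofFn_getD (w : List Bool) {a ℓ : ℕ} (h : a + ℓ ≤ w.length) :
    (w.drop a).take ℓ = List.ofFn fun j : Fin ℓ => w.getD (a + j) false := by
  apply List.ext_getElem
  · simp only [List.length_take, List.length_drop, List.length_ofFn]
    omega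
  · intro j h1 h2
    rw [List.getElem_ofFn, List.getElem_take, List.getElem_drop,
      List.getD_eq_getElem _ _ (by simp at h2; omega)]

/-- The half `b ∈ {0, 1}` of a `2ℓ`-bit string, read positionally at `cond [b = 1] (ℓ + j) j`, is
the block `w[ℓb, ℓb + ℓ)`. [folklore] -/
theorem ofFn_getD_cond_eq_take_drop (w : List Bool) {ℓ b : ℕ} (hw : w.length = 2 * ℓ)
    (hb : b ≤ 1) :
    (List.ofFn fun j : Fin ℓ => w.getD (cond (decide (b = 1)) (ℓ + j) j) false) =
      (w.drop (ℓ * b)).take ℓ := by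
  rw [take_drop_eq_ofFn_getD w (by rw [hw]; nlinarith)]
  congr 1
  funext j
  rcases Nat.le_one_iff_eq_zero_or_eq_one.1 hb with rfl | rfl <;> simp

/-- The numeral bit `b = ⌊t/2ᶜ⌋ mod 2 ∈ {0,1}` is the binary digit `t.testBit c`. [folklore] -/
private theorem decide_mod_two_eq_testBit (t c : ℕ) :
    decide (t / 2 ^ c % 2 = 1) = t.testBit c := by
  rw [Nat.testBit_eq_decide_div_mod_eq]

/-- `cond` of the digit recovers the numeral bit. [folklore] -/
private theorem cond_testBit_eq_mod (t c : ℕ) : cond (t.testBit c) 1 0 = t / 2 ^ c % 2 := by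
  rw [← decide_mod_two_eq_testBit]
  rcases Nat.mod_two_eq_zero_or_one (t / 2 ^ c) with h | h <;> simp [h]

/-- A fresh-label block inside the coin string: `(ρ ⇂ (k+ℓ)) [ℓq, ℓq+ℓ) = (ρ[k+ℓ+qℓ+j])_{j<ℓ}`.
[folklore] -/
private theorem freshBlock_eq (ρ : List Bool) (k ℓ q : ℕ) (h : k + ℓ + q * ℓ + ℓ ≤ ρ.length) :
    ((ρ.drop (k + ℓ)).drop (ℓ * q)).take ℓ =
      List.ofFn fun j : Fin ℓ => ρ.getD (k + ℓ + q * ℓ + j) false := by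
  rw [List.drop_drop, Nat.mul_comm ℓ q]
  exact take_drop_eq_ofFn_getD ρ (by omega)

/-- The fresh-label block read in a walk step lies inside the coin string. [folklore] -/
private theorem freshBlock_bound {k c t ℓ R : ℕ} (hck : c + 1 ≤ k) (ht : t < 2 ^ k)
    (hK : k + ℓ + 2 ^ (k + 1) * ℓ ≤ R) :
    k + ℓ + (2 * (2 ^ (k - (c + 1)) - 1 + t / 2 ^ (c + 1)) + t / 2 ^ c % 2) * ℓ + ℓ ≤ R := by
  have h3 : t / 2 ^ (c + 1) < 2 ^ (k - (c + 1)) := by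
    rw [Nat.div_lt_iff_lt_mul (Nat.two_pow_pos _), ← pow_add]
    have e : k - (c + 1) + (c + 1) = k := by omega
    rwa [e]
  have h4 : 2 ^ (k - (c + 1)) * 2 ≤ 2 ^ k := by
    rw [← pow_succ]
    exact Nat.pow_le_pow_right (by norm_num) (by omega)
  have h1 : 1 ≤ 2 ^ (k - (c + 1)) := Nat.one_le_two_pow
  have hb : t / 2 ^ c % 2 ≤ 1 := Nat.le_of_lt_succ (Nat.mod_lt _ Nat.two_pos)
  have h2k : 2 ^ (k + 1) = 2 ^ k * 2 := pow_succ 2 k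
  have hq : 2 * (2 ^ (k - (c + 1)) - 1 + t / 2 ^ (c + 1)) + t / 2 ^ c % 2 + 1 ≤ 2 ^ (k + 1) := by
    omega
  have hq' := Nat.mul_le_mul_right ℓ hq
  have e : (2 * (2 ^ (k - (c + 1)) - 1 + t / 2 ^ (c + 1)) + t / 2 ^ c % 2 + 1) * ℓ =
      (2 * (2 ^ (k - (c + 1)) - 1 + t / 2 ^ (c + 1)) + t / 2 ^ c % 2) * ℓ + ℓ := by ring
  rw [e] at hq'
  omega

/-! ### The walk -/

/-- **The label of a leaf of a hybrid GGM tree is computable in polynomial time.** For `G ∈ FP`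
there is `walk ∈ FP` such that for all `y, z, ρ` and `ℓ ≥ 1`, `k`, `i < 2ᵏ`, `t < 2ᵏ` with
`|z| = 2ℓ`, `|G ⟨y, s⟩| = 2ℓ` for `|s| = ℓ`, and `k + ℓ + 2^{k+1} ℓ ≤ |ρ|`: on the record
`⟨⟨y, ⟨z, ⟨ρ ⇂ (k+ℓ), ⟨1^ℓ, ⟨bin k, ⟨bin i, bin t⟩⟩⟩⟩⟩⟩, ρ[k, k+ℓ)⟩` the value of `walk` is the
bit string of the label of leaf `t` (the `t`-th point of the cube) of the depth-`k` distinguisher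
tree `distLab g ρ_ω x i z_h` whose step maps are the halves of `s ↦ G ⟨y, s⟩`, whose root is
`x = ρ[k, k+ℓ)`, whose fresh labels are the blocks `ρ[k+ℓ+(2n+b)ℓ, +ℓ)` and whose challenge is
the pair of halves of `z` (the loop `Brick.loopFn_mem_FP` over the body of `exists_walkBody`,
`k` rounds from the root; invariant `distLab_ancestor_succ`).
[cite: AllenderEtAl2006, Thm. 45 (proof, p. 24)] [cite: AroraBarak2009, §1.3 and proof of Thm. 9.17] -/
theorem exists_walk {G : List Bool → List Bool} (hG : G ∈ FP) :
    ∃ walk : List Bool → List Bool, walk ∈ FP ∧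
      ∀ (y z ρ : List Bool) (ℓ k i t : ℕ) (ht : t < 2 ^ k), 1 ≤ ℓ → i < 2 ^ k →
        z.length = 2 * ℓ → (∀ s : List Bool, s.length = ℓ → (G (boolPair y s)).length = 2 * ℓ) →
        k + ℓ + 2 ^ (k + 1) * ℓ ≤ ρ.length →
        walk (boolPair
            (boolPair y (boolPair z (boolPair (ρ.drop (k + ℓ)) (boolPair (ones ℓ)
              (boolPair (encodeNat k) (boolPair (encodeNat i) (encodeNat t)))))))
            ((ρ.drop k).take ℓ)) =
          List.ofFn (distLab
            (fun (b : Bool) (s : Fin ℓ → Bool) (j : Fin ℓ) =>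
              (G (boolPair y (List.ofFn s))).getD (cond b (ℓ + j) j) false)
            (Sample.rho (σ := Fin ℓ → Bool) (n := k)
              ((fun j : Fin ℓ => ρ.getD (k + j) false),
                fun (t' : Fin (2 ^ k)) (b : Bool) (j : Fin ℓ) =>
                  ρ.getD (k + ℓ + (2 * t' + cond b 1 0) * ℓ + j) false))
            (fun j : Fin ℓ => ρ.getD (k + j) false) i
            (fun (b : Bool) (j : Fin ℓ) => z.getD (cond b (ℓ + j) j) false)
            k ((boolFunEquivFin k).symm ⟨t, ht⟩)) := by
  obtain ⟨body, hbody, hgrowth, hsem⟩ := exists_walkBody hG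
  -- the machine: initialise `⟨X, ⟨bin k, x₀⟩⟩`, loop `|X|` rounds, read the label
  let init : List Bool → List Bool := fanoutFn fstF (fanoutFn (nthF 4 ∘ fstF) sndF)
  let loop : List Bool → List Bool := fun w =>
    (loopStep body)^[(Polynomial.X : Polynomial ℕ).eval (fstF w).length] w
  let walk : List Bool → List Bool := sndPow 1 ∘ loop ∘ init
  have hinit : init ∈ FP :=
    fanoutFn_mem_FP fstF_mem_FP (fanoutFn_mem_FP (comp_mem_FP (nthF_mem_FP 4) fstF_mem_FP) sndF_mem_FP)
  have hloop : loop ∈ FP := by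
    refine loopFn_mem_FP hbody (c := 1) (fun w => ?_) Polynomial.X
    have h1 := hgrowth w
    have h2 := length_nthF_le 3 (nthF 0 w)
    simp only [nthF_zero] at h1 h2
    omega
  have hwalk : walk ∈ FP :=
    comp_mem_FP (g := sndPow 1) (f := loop ∘ init) (sndPow_mem_FP 1)
      (comp_mem_FP (g := loop) (f := init) hloop hinit)
  refine ⟨walk, hwalk, ?_⟩
  intro y z ρ ℓ k i t ht hℓ hi hz hG2 hK
  -- opaque names for the data of the statement
  obtain ⟨X, hX⟩ : ∃ X : List Bool, X = boolPair y (boolPair z (boolPair (ρ.drop (k + ℓ))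
      (boolPair (ones ℓ) (boolPair (encodeNat k) (boolPair (encodeNat i) (encodeNat t)))))) :=
    ⟨_, rfl⟩
  obtain ⟨gσ, hgσ⟩ : ∃ gσ : Bool → (Fin ℓ → Bool) → (Fin ℓ → Bool),
      gσ = fun (b : Bool) (s : Fin ℓ → Bool) (j : Fin ℓ) =>
        (G (boolPair y (List.ofFn s))).getD (cond b (ℓ + (j : ℕ)) (j : ℕ)) false :=
    ⟨fun b s j => (G (boolPair y (List.ofFn s))).getD (cond b (ℓ + (j : ℕ)) (j : ℕ)) false, rfl⟩
  obtain ⟨xσ, hxσ⟩ : ∃ xσ : Fin ℓ → Bool, xσ = fun j : Fin ℓ => ρ.getD (k + (j : ℕ)) false :=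
    ⟨fun j => ρ.getD (k + (j : ℕ)) false, rfl⟩
  obtain ⟨ω₂, hω₂⟩ : ∃ ω₂ : Fin (2 ^ k) → Bool → Fin ℓ → Bool,
      ω₂ = fun (t' : Fin (2 ^ k)) (b : Bool) (j : Fin ℓ) =>
        ρ.getD (k + ℓ + (2 * (t' : ℕ) + cond b 1 0) * ℓ + (j : ℕ)) false :=
    ⟨fun t' b j => ρ.getD (k + ℓ + (2 * (t' : ℕ) + cond b 1 0) * ℓ + (j : ℕ)) false, rfl⟩
  obtain ⟨zσ, hzσ⟩ : ∃ zσ : Bool → Fin ℓ → Bool,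
      zσ = fun (b : Bool) (j : Fin ℓ) => z.getD (cond b (ℓ + (j : ℕ)) (j : ℕ)) false :=
    ⟨fun b j => z.getD (cond b (ℓ + (j : ℕ)) (j : ℕ)) false, rfl⟩
  -- sizes
  have hkℓ : k ≤ 2 ^ (k + 1) * ℓ := by
    have h1 : k < 2 ^ k := Nat.lt_two_pow_self
    have h2 : 2 ^ k ≤ 2 ^ (k + 1) * ℓ := by
      rw [pow_succ]
      calc 2 ^ k ≤ 2 ^ k * 2 := Nat.le_mul_of_pos_right _ two_pos
        _ ≤ 2 ^ k * 2 * ℓ := Nat.le_mul_of_pos_right _ hℓ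
    omega
  have hρ'len : (ρ.drop (k + ℓ)).length = ρ.length - (k + ℓ) := List.length_drop
  have hkρ' : k ≤ (ρ.drop (k + ℓ)).length := by rw [hρ'len]; omega
  have hℓ2 : 2 ^ (k + 1) ≤ 2 ^ (k + 1) * ℓ := Nat.le_mul_of_pos_right _ hℓ
  have h2ρ' : 2 ^ (k + 1) ≤ (ρ.drop (k + ℓ)).length := by rw [hρ'len]; omega
  have hℓ1 : ℓ ≤ 2 ^ (k + 1) * ℓ := Nat.le_mul_of_pos_left ℓ (Nat.two_pow_pos _)
  -- the root label is `xσ`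
  have hroot : (ρ.drop k).take ℓ = List.ofFn xσ := by
    rw [hxσ]
    exact take_drop_eq_ofFn_getD ρ (by omega)
  -- equal paths give equal labels (to realign the depth index `k - c = (k - (c+1)) + 1`)
  have hpath : ∀ (d d' : ℕ) (hd : d = d') (q : Fin d → Bool) (q' : Fin d' → Bool),
      (∀ (j : ℕ) (h : j < d) (h' : j < d'), q ⟨j, h⟩ = q' ⟨j, h'⟩) →
      distLab gσ (Sample.rho (xσ, ω₂)) xσ i zσ d q = distLab gσ (Sample.rho (xσ, ω₂)) xσ i zσ d' q' := by
    rintro d d' rfl q q' hq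
    rw [show q = q' from funext fun j => hq j j.isLt j.isLt]
  -- **the loop invariant**: from counter `c` and the label of the depth-`(k - c)` ancestor, the
  -- loop ends at the label of the leaf
  have key : ∀ c : ℕ, c ≤ k → ∀ L : List Bool,
      L = List.ofFn (distLab gσ (Sample.rho (xσ, ω₂)) xσ i zσ (k - c)
        (fun j : Fin (k - c) => (boolFunEquivFin k).symm ⟨t, ht⟩ ⟨j + (k - (k - c)), by omega⟩)) →
      loopModel body X c L =
        List.ofFn (distLab gσ (Sample.rho (xσ, ω₂)) xσ i zσ k ((boolFunEquivFin k).symm ⟨t, ht⟩)) := by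
    intro c
    induction c with
    | zero =>
      intro _ L hL
      rw [loopModel, hL]
      refine congrArg List.ofFn (hpath _ _ (Nat.sub_zero k) _ _ fun j h h' => ?_)
      exact congrArg _ (Fin.ext (by simp))
    | succ c ih =>
      intro hck L hL
      rw [loopModel]
      refine ih (by omega) _ ?_
      -- the body performs one step of the arithmetic walk
      have hLlen : L.length = ℓ := by rw [hL, List.length_ofFn]
      have hs := hsem y z (ρ.drop (k + ℓ)) L ℓ k i t c hck hkρ' h2ρ' hz (hG2 L hLlen) hℓ ht hi
      rw [← hX] at hs
      rw [hs]
      -- the target ancestor label through the walk lemma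
      have e2 : k - (c + 1) + 1 = k - c := by omega
      have hlab : List.ofFn (distLab gσ (Sample.rho (xσ, ω₂)) xσ i zσ (k - c)
          (fun j : Fin (k - c) => (boolFunEquivFin k).symm ⟨t, ht⟩ ⟨j + (k - (k - c)), by omega⟩)) =
          List.ofFn (distLab gσ (Sample.rho (xσ, ω₂)) xσ i zσ (k - (c + 1) + 1)
            (fun j : Fin (k - (c + 1) + 1) =>
              (boolFunEquivFin k).symm ⟨t, ht⟩ ⟨j + (k - (k - (c + 1) + 1)), by omega⟩)) := by
        refine congrArg List.ofFn (hpath _ _ e2.symm _ _ fun j h h' => ?_)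
        exact congrArg _ (Fin.ext (by simp only; omega))
      rw [hlab, distLab_ancestor_succ gσ (Sample.rho (xσ, ω₂)) xσ i zσ k ⟨t, ht⟩ (k - (c + 1))
        (by omega)]
      have e1 : k - c - 1 = k - (c + 1) := by omega
      have e3 : k - (k - (c + 1)) = c + 1 := by omega
      simp only [e3, e1, Nat.add_sub_cancel]
      -- sizes of the node number
      have hn_lt : 2 ^ (k - (c + 1)) - 1 + t / 2 ^ (c + 1) < 2 ^ k := by
        have h3 : t / 2 ^ (c + 1) < 2 ^ (k - (c + 1)) := by
          rw [Nat.div_lt_iff_lt_mul (Nat.two_pow_pos _), ← pow_add]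
          have e : k - (c + 1) + (c + 1) = k := by omega
          rwa [e]
        have h4 : 2 ^ (k - (c + 1)) * 2 ≤ 2 ^ k := by
          rw [← pow_succ]
          exact Nat.pow_le_pow_right (by norm_num) (by omega)
        have : 1 ≤ 2 ^ (k - (c + 1)) := Nat.one_le_two_pow
        omega
      have hb_le : t / 2 ^ c % 2 ≤ 1 := Nat.le_of_lt_succ (Nat.mod_lt _ Nat.two_pos)
      split_ifs with h1 h2
      · -- a fresh label
        rw [Sample.rho_of_lt _ hn_lt]
        simp only [hω₂, cond_testBit_eq_mod]
        exact freshBlock_eq ρ k ℓ _ (freshBlock_bound hck ht hK)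
      · -- the challenge
        simp only [hzσ, ← decide_mod_two_eq_testBit]
        exact (ofFn_getD_cond_eq_take_drop z hz hb_le).symm
      · -- one application of a half of `G`
        have hLσ : List.ofFn (distLab gσ (Sample.rho (xσ, ω₂)) xσ i zσ (k - (c + 1))
            (fun j : Fin (k - (c + 1)) => (boolFunEquivFin k).symm ⟨t, ht⟩ ⟨j + (c + 1), by omega⟩)) = L := by
          rw [hL]
          exact congrArg List.ofFn (hpath _ _ rfl _ _ fun j h h' =>
            congrArg _ (Fin.ext (by simp only; omega)))
        simp only [hgσ, ← decide_mod_two_eq_testBit] at hLσ ⊢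
        rw [hLσ]
        exact (ofFn_getD_cond_eq_take_drop _ (hG2 L hLlen) hb_le).symm
  -- run the machine
  have hXlen : k ≤ X.length := by
    rw [hX]
    simp only [length_boolPair]
    omega
  have h4 : nthF 4 X = encodeNat k := by rw [hX]; simp
  have hrun : walk (boolPair X ((ρ.drop k).take ℓ)) = loopModel body X k ((ρ.drop k).take ℓ) := by
    simp only [walk, loop, init, Function.comp_apply, fanoutFn_apply, fstF_boolPair,
      sndF_boolPair, Polynomial.eval_X]
    rw [h4, iterate_loopStep body X k X.length _ hXlen]
    simp
  have hzero : ∀ (d : ℕ) (q : Fin d → Bool), d = 0 →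
      distLab gσ (Sample.rho (xσ, ω₂)) xσ i zσ d q = xσ := by
    rintro d q rfl; rfl
  have hfinal := key k le_rfl (List.ofFn xσ) (by rw [hzero _ _ (Nat.sub_self k)])
  rw [← hX, hrun, hroot, hfinal, hgσ, hxσ, hω₂, hzσ]

end Literature.Computability.MetaComplexity
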